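import Summits.Ventures.AbcSig.Rows.Bridge
import Summits.Ventures.AbcSig.Rows.XnYn3Z2OddXCell

/-!
# Venture AbcSig — FULL CELL `xⁿ + yⁿ = 3 z²` (both parities): [BS04, Thm 1.1], C = 3 — REPRODUCTION assembled in Lean

HONEST FRAMING. COMPUTATION cell `pub-abcsig`; CONDITIONAL theorem; no claim on ABC or any summit. This file only composes
p1's bookkeeping `Rows.C1Cell_of_halves` with the even half `C1CellEven_3_of` (`Rows/Bridge.lean`, from `row_XnYn3Z2Even` — level 18, NO newforms, `DataComplete 18 level18Orbits`
with the empty list) and the odd-half bridge `C1CellOdd_3_of` (level 288, norm-form data file; every orbit a CITED exclusion: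
CM by ℚ(i) / potentially multiplicative at 3, [BS04, Prop 4.6 / 4.4] as in the row of record `census/rows/C1/C1-C3-all.md`, R8 ref-g5).
Hypotheses = union of the two halves. Conclusion: for every prime `n ≥ 7`, `n ≠ 3`, `xⁿ + yⁿ = 3z²` has no primitive solution.
-/

namespace Summit.Ventures.AbcSig

/-- `xⁿ + yⁿ = 3 z²` has no primitive solution for any prime `n ≥ 7`, `n ≠ 3` ([BS04, Thm 1.1], C = 3, both parities), conditional on
the hypotheses of the two halves (`BS04Package`; `DataComplete 18` / `DataComplete 288` + `RefinesCPSymAll 288`; the odd half's five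
CITED per-orbit exclusions). -/
theorem C3_full_of (M : NewformModel) (hP : M.BS04Package) (hD18 : M.DataComplete 18 level18Orbits)
    (hD288 : M.DataComplete 288 level288Orbits) (hCP288 : M.RefinesCPSymAll 288 level288CP)
    (hX_orbit_288_1 : ∀ n : ℕ, M.Excludes 288 orbit_288_1 (fun S => S.A = 1 ∧ S.B = 1 ∧ S.C = 3 ∧ S.n = n ∧ ¬ 2 ∣ S.a * S.b))
    (hX_orbit_288_2 : ∀ n : ℕ, M.Excludes 288 orbit_288_2 (fun S => S.A = 1 ∧ S.B = 1 ∧ S.C = 3 ∧ S.n = n ∧ ¬ 2 ∣ S.a * S.b))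
    (hX_orbit_288_3 : ∀ n : ℕ, M.Excludes 288 orbit_288_3 (fun S => S.A = 1 ∧ S.B = 1 ∧ S.C = 3 ∧ S.n = n ∧ ¬ 2 ∣ S.a * S.b))
    (hX_orbit_288_4 : ∀ n : ℕ, M.Excludes 288 orbit_288_4 (fun S => S.A = 1 ∧ S.B = 1 ∧ S.C = 3 ∧ S.n = n ∧ ¬ 2 ∣ S.a * S.b))
    (hX_orbit_288_5 : ∀ n : ℕ, M.Excludes 288 orbit_288_5 (fun S => S.A = 1 ∧ S.B = 1 ∧ S.C = 3 ∧ S.n = n ∧ ¬ 2 ∣ S.a * S.b)) :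
    ∀ n : ℕ, n.Prime → 7 ≤ n → ¬ n ∣ 3 → ∀ x y z : ℤ, ¬ IsPrimitiveSolution 1 1 3 n x y z := by
  intro n hn h7 h3 x y z
  exact Rows.C1Cell_of_halves 3 7 ∅ (C1CellEven_3_of M hP hD18)
    (C1CellOdd_3_of M hP hD288 hCP288 hX_orbit_288_1 hX_orbit_288_2 hX_orbit_288_3 hX_orbit_288_4 hX_orbit_288_5)
    n hn h7 h3 (by simp) x y z

end Summit.Ventures.AbcSig
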